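import Literature.NumberTheory.EllipticCurves.BurungaleSkinner2023.Curve14a1TwistsCertificate
import HarnessLib

/-!
# Burungale–Skinner 2023, Corollary 3.4 is NOT vacuous: its hypotheses for `14A1`, `ℓ₀ = 2`,
# `χ = χ_{ℚ(√5)}` KERNEL-CHECKED (proofs only)

A. Burungale, C. Skinner, Proc. AMS Ser. B 10 (2023), Cor. 3.4 (p. 26; typed as
`Cor34Hypotheses` / `cor34_evenTwist_pPartBSD_rankZero` in `EisensteinTwistsBSDFormula.lean`): the
explicit even-character companion of Thm. 3.5 — `3 ∤ N`, a rational line `Φ` of order `3` with `ϕ`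
even-unramified or odd-ramified at `3`, `ℓ₀ ∣ N` with `r_{ℓ₀} = 1`, an even quadratic `χ` with
`(3N, cond_r χ) = 1` and (a)–(e); then `L(E^χ,1) ≠ 0 ⇒` the `3`-part of the rank-zero BSD formula.

This file inhabits the typed hypothesis bundle on the curve of Example (E1): `E = 14A1`
(`Curve14a1TwistsCertificate`: `N = 14`, `S = {7}`, `N = {2}`, `A = ∅`, `Φ = ⟨T̄₃⟩`, `ϕ = 1`),
`ℓ₀ = 2 ∈ N` (`r₂ = 1`), and `χ = χ_F` for `F` the real quadratic field of discriminant `5`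
(`F' = F` as `ϕ = 1`): `(42, 5) = 1`; (a) `χ(2) = −1` (`5 ≡ 5 mod 8`: `2` inert); (b) `7 ∈ S`,
`χ(7) = −1` (`(5/7) = −1`); (c), (d) vacuous; (e) `χ(3) = −1` (`(5/3) = −1`). Hence
(`pPartBSD_rankZero_twist_c14a1_five`): **modulo Cor. 3.4 by name, if `L(E^{(5)}, 1) ≠ 0` for
`E = 14A1` then the `3`-part of the BSD formula holds for every global minimal model of `E^{(5)}`**
(the twist of conductor `350`). Theorems only; no new facts.

References: [BurungaleSkinner2023] Cor. 3.4 (p. 26), Example (E1) (p. 22); [Marcus2018] Ch. 3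
Thm. 25; [Cox2013] §5.B.
-/

noncomputable section

open scoped Classical

open NumberField IsDedekindDomain IsDedekindDomain.HeightOneSpectrum WeierstrassCurve Polynomial
  Literature.NumberTheory.EllipticCurves Literature.NumberTheory.EllipticCurves.Rank1Residual
  Literature.NumberTheory.QuadraticFields.Quadratic

namespace Literature.NumberTheory.EllipticCurves.BurungaleSkinner2023

/-- `5 = d_{ℚ(√5)}` is the discriminant of a real quadratic field. [cite: Cox2013, §5.B] -/
theorem isEvenQuadraticCharDiscr_five : IsEvenQuadraticCharDiscr 5 := by
  refine isEvenQuadraticCharDiscr_iff.mpr ⟨Or.inl ⟨by decide, ?_, by decide⟩, by norm_num⟩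
  rw [← Int.squarefree_natAbs]
  exact (show Nat.Prime 5 by norm_num).prime.squarefree

/-- **All hypotheses of Cor. 3.4 for `(14A1, Φ = ⟨T̄₃⟩, ℓ₀ = 2, F = F' = a real quadratic field of
discriminant 5)`**: `3 ∤ 14`; `ϕ = 1` (even, unramified); `2 ∣ 14`, `r₂ = 1`, `2 ∉ A`, no additive
prime; `χ = χ_5` even quadratic with `(42, 5) = 1`; (a) `2 ∈ N`, `χ(2) = −1` (`5 ≡ 5 (mod 8)`);
(b) `7 ∈ S`, `χ(7) = −1` (`(5/7) = −1`); (c), (d) vacuous; (e) `χ(3) = −1` (`(5/3) = −1`).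
[cite: BurungaleSkinner2023, Cor. 3.4 (hypotheses, p. 26) with Example (E1) (p. 22)] -/
theorem cor34Hypotheses_c14a1_of_discr_eq_five [Fact (Nat.Prime 7)] (F : Type) [Field F]
    [NumberField F] (h2 : Module.finrank ℚ F = 2) (hreal : NumberField.IsTotallyReal F)
    (hd : NumberField.discr F = 5) :
    haveI := isGloballyMinimal_c14a1
    ∃ Φ : AddSubgroup (geomTorsion c14a1 ((3 : ℕ) : ℤ)), Cor34Hypotheses c14a1 Φ 2 F F := by
  haveI := isElliptic_c14a1
  haveI := isGloballyMinimal_c14a1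
  obtain ⟨Φ, hcard, htriv⟩ := line_c14a1
  have h7 : ∀ (ℓ : ℕ) [Fact ℓ.Prime], ℓ ≠ 2 → ℓ ≠ 7 → ¬ c14a1.HasMultiplicativeReductionAtPrime ℓ :=
    fun ℓ _ h2' h7' => (hasGoodReductionAtPrime_c14a1 h2' h7').not_hasMultiplicativeReduction
  have hgood : ∀ (ℓ : ℕ) [Fact ℓ.Prime], ℓ ≠ 2 → ¬ Addv c14a1 ℓ := by
    intro ℓ _ h2' hA
    by_cases h7' : ℓ = 7
    · subst h7'
      exact hA.2 hasMultiplicativeReductionAtPrime_c14a1_seven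
    · exact hA.1 (hasGoodReductionAtPrime_c14a1 h2' h7')
  refine ⟨Φ, ?_⟩
  exact {
    three_not_dvd_conductor := by rw [conductorNorm_c14a1]; decide
    isRationalLine := ⟨hcard, fun σ P hP => by rw [htriv σ P hP]; exact hP⟩
    parity := Or.inl ⟨lineEven_of_forall_smul_eq htriv, lineUnramifiedAt_of_forall_smul_eq htriv⟩
    ell0_dvd_conductor := by rw [conductorNorm_c14a1]; decide
    numPrimesAbove_ell0 := numPrimesAbove_three_two
    ell0_mod_three_of_addv := fun _ => by decide
    addv_mod_three := fun ℓ _ h2' hA _ => absurd hA (hgood ℓ h2')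
    finrank_eq_two := h2
    isTotallyReal := hreal
    finrank_eq_two' := h2
    isProductCharacterField := isProductCharacterField_self_of_forall_smul_eq htriv F h2
    not_dvd_discr := by
      intro ℓ hℓ h42 h5
      rw [conductorNorm_c14a1] at h42
      rw [hd] at h5
      have h5' : ℓ ∣ 5 := by exact_mod_cast h5
      have hℓ5 : ℓ = 5 := (Nat.prime_dvd_prime_iff_eq hℓ (by norm_num)).mp h5'
      subst hℓ5
      revert h42
      decide
    a_split := fun hs => absurd hs not_hasSplitMultiplicativeReductionAtPrime_c14a1_two
    a_nonsplit := fun _ _ => isInertIn_two_of_discr_emod_eight h2 (by rw [hd]; decide)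
    a_addv := fun _ => by rw [hd]; decide
    b := by
      intro ℓ _ h2' hs
      by_cases h7' : ℓ = 7
      · subst h7'
        exact isInertIn_of_legendreSym_eq_neg_one h2 (by rw [hd]; norm_num)
      · exact absurd hs.hasMultiplicativeReductionAtPrime (h7 ℓ h2' h7')
    c := by
      intro ℓ _ h2' hm hns
      by_cases h7' : ℓ = 7
      · subst h7'
        exact absurd hasSplitMultiplicativeReductionAtPrime_c14a1_seven hns
      · exact absurd hm (h7 ℓ h2' h7')
    d := fun ℓ _ h2' hA _ _ => absurd hA (hgood ℓ h2')
    e := isInertIn_of_legendreSym_eq_neg_one h2 (by rw [hd]; norm_num) }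

/-- **The `3`-part of the rank-zero BSD formula for the twist `E^{(5)}` of `E = 14A1`, granted
`L(E^{(5)}, 1) ≠ 0`, modulo Cor. 3.4 by name** (`cor34_evenTwist_pPartBSD_rankZero`), every
hypothesis of which is kernel-checked above (so `Cor34Hypotheses` is inhabited).
[cite: BurungaleSkinner2023, Cor. 3.4 (p. 26) with Example (E1) (p. 22)] -/
theorem pPartBSD_rankZero_twist_c14a1_five [Fact (Nat.Prime 7)]
    (hcor : cor34_evenTwist_pPartBSD_rankZero)
    (hL : haveI := isElliptic_c14a1; (c14a1.quadraticTwist ((5 : ℤ) : ℚ)).entireLFunction 1 ≠ 0) :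
    haveI := isElliptic_c14a1
    ∀ (W' : WeierstrassCurve ℚ) [W'.IsElliptic] [W'.IsGloballyMinimal] (C : VariableChange ℚ),
      C • c14a1.quadraticTwist ((5 : ℤ) : ℚ) = W' → PPartRankZeroPrintShape W' 3 := by
  haveI := isElliptic_c14a1
  haveI := isGloballyMinimal_c14a1
  obtain ⟨F, _, _, h2, hreal, hd⟩ := isEvenQuadraticCharDiscr_five
  obtain ⟨Φ, hΦ⟩ := cor34Hypotheses_c14a1_of_discr_eq_five F h2 hreal hd
  have hc := hcor c14a1 Φ 2 F F hΦ
  rw [hd] at hc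
  exact hc hL

end Literature.NumberTheory.EllipticCurves.BurungaleSkinner2023

end
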